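import Mathlib
import Summits.Ventures.PercRepro2.TwoHullMasterGlue2
import Summits.Ventures.PercRepro2.TwoHullMasterPathRuns
import Summits.Ventures.PercRepro2.TwoHullMasterGlue

/-!
# The interface involution of a path is a side involution; (MM) on two internally disjoint paths
(blind cell PercRepro2, night-4 g39, 2026-08-29; proofs/NIGHT4-G39.md §7, Theorem 2)

`flipHead` with the colour of the first edge is a `SideInvolution` of the path `p 0 – ⋯ – p k`
with marks `p 0`, `p k` (**`sideInvolution_path`**): it mirrors the prefix runs
(`pre_flipHead_iff`), moves the suffix runs up when the first edge is red and down when it is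
blue (`hullPair_last_flipHead_up` / `_down`, the four shapes of the tail), and the first edge's
colour fixes the side of the diamond (`diamond_path_up` / `_down`).  Hence
**`twoHullMaster_twoPaths`**: (MM) holds on the two-vertex gluing of two paths at their ends — every
cycle through `l` and `h`, and with the cut-vertex reductions of TwoHullMasterGlue.lean every graph
`G_l ∪_l (P¹ ∪_{l,h} P²) ∪_h G_h` (Theorem 2 of the record, `twoHullMaster_twoPaths_glue`).
-/

namespace Summit.Ventures.PercRepro2

namespace Path2

open Hull LocRows Glue2

open scoped Classical

variable {V : Type*} {k : ℕ} {p : Fin (k + 1) → V}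

/-- The colour of the first edge (`true` on the empty path). -/
def headColour (ζ : Config (Fin k)) : Bool := if hk : 0 < k then ζ ⟨0, hk⟩ else true

section Moves

variable (hp : Function.Injective p) {ζ : Config (Fin k)} (hc : ¬ IsConst ζ)
include hp hc

omit hp hc in
/-- The first edge has the colour `!ζ r` at the first mismatch `r`. -/
lemma headColour_eq {r : Fin k} (hr : InHead ζ r) {j₀ : Fin k} (hj₀ : j₀ < r) (hne : ζ j₀ ≠ ζ r) :
    headColour ζ = !ζ r := by
  have hk : 0 < k := lt_of_le_of_lt (Nat.zero_le _) r.isLt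
  have h0r : (⟨0, hk⟩ : Fin k) < r := Fin.lt_def.2 (by have := Fin.lt_def.1 hj₀; simp; omega)
  simp only [headColour, hk, dif_pos]
  exact eq_not_of_lt hr hj₀ hne h0r

/-- The diamond at `l`: a red first edge makes the hull pair of `p 0` dominate its swap. -/
lemma diamond_path_up (h : headColour ζ = true) :
    PairLE (hullPair (pathEnds p) ζ (p 0)).swap (hullPair (pathEnds p) ζ (p 0)) := by
  obtain ⟨r, hr, j₀, hj₀, hne⟩ := exists_first_mismatch hc
  have hk : 0 < k := lt_of_le_of_lt (Nat.zero_le _) r.isLt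
  have hζr : ζ r = false := by
    have := headColour_eq hr hj₀ hne; rw [h] at this
    cases h1 : ζ r with
    | false => rfl
    | true => rw [h1] at this; simp at this
  have h0r : (⟨0, hk⟩ : Fin k) < r := Fin.lt_def.2 (by have := Fin.lt_def.1 hj₀; simp; omega)
  rw [hullPair_zero hp]
  have hsub : pathSet p (Pre ζ false) ⊆ pathSet p (Pre ζ true) := by
    refine pathSet_mono fun v hv i hi => ?_
    exfalso
    have h0 := hv ⟨0, hk⟩ (by show (0 : ℕ) < (v : ℕ); omega)
    rw [eq_not_of_lt hr hj₀ hne h0r, hζr] at h0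
    simp at h0
  exact ⟨hsub, hsub⟩

/-- The diamond at `l`: a blue first edge makes the hull pair of `p 0` dominated by its swap. -/
lemma diamond_path_down (h : headColour ζ = false) :
    PairLE (hullPair (pathEnds p) ζ (p 0)) (hullPair (pathEnds p) ζ (p 0)).swap := by
  obtain ⟨r, hr, j₀, hj₀, hne⟩ := exists_first_mismatch hc
  have hk : 0 < k := lt_of_le_of_lt (Nat.zero_le _) r.isLt
  have hζr : ζ r = true := by
    have := headColour_eq hr hj₀ hne; rw [h] at this
    cases h1 : ζ r with
    | true => rfl
    | false => rw [h1] at this; simp at this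
  have h0r : (⟨0, hk⟩ : Fin k) < r := Fin.lt_def.2 (by have := Fin.lt_def.1 hj₀; simp; omega)
  rw [hullPair_zero hp]
  have hsub : pathSet p (Pre ζ true) ⊆ pathSet p (Pre ζ false) := by
    refine pathSet_mono fun v hv i hi => ?_
    exfalso
    have h0 := hv ⟨0, hk⟩ (by show (0 : ℕ) < (v : ℕ); omega)
    rw [eq_not_of_lt hr hj₀ hne h0r, hζr] at h0
    simp at h0
  exact ⟨hsub, hsub⟩

/-- **The hull pair of `p k` moves in the direction of the first edge's colour** under `flipHead`:
up when it is red, down when it is blue. -/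
lemma hullPair_last_flipHead_move :
    (headColour ζ = true →
      PairLE (hullPair (pathEnds p) ζ (p (Fin.last k))) (hullPair (pathEnds p) (flipHead ζ) (p (Fin.last k)))) ∧
    (headColour ζ = false →
      PairLE (hullPair (pathEnds p) (flipHead ζ) (p (Fin.last k))) (hullPair (pathEnds p) ζ (p (Fin.last k)))) := by
  obtain ⟨r, hr, j₀, hj₀, hne⟩ := exists_first_mismatch hc
  have hcol := headColour_eq hr hj₀ hne
  rw [hullPair_last hp, hullPair_last hp]
  by_cases hlast : ∀ i : Fin k, ¬ r < i
  · -- (D) the mismatch is the last edge: the pair mirrors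
    have hmir : (pathSet p (Suf (flipHead ζ) true), pathSet p (Suf (flipHead ζ) false)) =
        (pathSet p (Suf ζ true), pathSet p (Suf ζ false)).swap := by
      simp only [Prod.swap]
      congr 1
      · exact pathSet_congr fun v => by rw [suf_flipHead_iff_of_last hr hj₀ hne hlast]; rfl
      · exact pathSet_congr fun v => by rw [suf_flipHead_iff_of_last hr hj₀ hne hlast]; rfl
    rw [hmir]
    cases hζr : ζ r with
    | false =>
      rw [hζr] at hcol
      refine ⟨fun _ => ?_, fun h' => by simp_all⟩
      have hsub : pathSet p (Suf ζ true) ⊆ pathSet p (Suf ζ false) := by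
        refine pathSet_mono fun v hv i hi => ?_
        exfalso
        have hir : i ≤ r := not_lt.1 (hlast i)
        have := hv r (by have := Fin.le_def.1 hir; omega)
        rw [hζr] at this
        simp at this
      exact ⟨hsub, hsub⟩
    | true =>
      rw [hζr] at hcol
      refine ⟨fun h' => by simp_all, fun _ => ?_⟩
      have hsub : pathSet p (Suf ζ false) ⊆ pathSet p (Suf ζ true) := by
        refine pathSet_mono fun v hv i hi => ?_
        exfalso
        have hir : i ≤ r := not_lt.1 (hlast i)
        have := hv r (by have := Fin.le_def.1 hir; omega)
        rw [hζr] at this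
        simp at this
      exact ⟨hsub, hsub⟩
  · obtain ⟨i₁, hi₁⟩ : ∃ i : Fin k, r < i := by
      by_contra h'
      exact hlast fun i hi => h' ⟨i, hi⟩
    by_cases hT1 : Tail ζ r (!ζ r)
    · cases hζr : ζ r with
      | false =>
        rw [hζr] at hcol
        refine ⟨fun _ => ?_, fun h' => by simp_all⟩
        refine ⟨pathSet_mono fun v hv => ?_, pathSet_mono fun v hv => ?_⟩
        · have := suf_mono_of_tail_first hr hj₀ hne v (by rw [hζr]; exact hv)
          rwa [hζr] at this
        · have := (suf_flipHead_iff_of_tail_first hr hj₀ hne hT1 hi₁ v).1 (by rw [hζr]; exact hv)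
          rwa [hζr] at this
      | true =>
        rw [hζr] at hcol
        refine ⟨fun h' => by simp_all, fun _ => ?_⟩
        refine ⟨pathSet_mono fun v hv => ?_, pathSet_mono fun v hv => ?_⟩
        · have := (suf_flipHead_iff_of_tail_first hr hj₀ hne hT1 hi₁ v).1 (by rw [hζr]; exact hv)
          rwa [hζr] at this
        · have := suf_mono_of_tail_first hr hj₀ hne v (by rw [hζr]; exact hv)
          rwa [hζr] at this
    · by_cases hT2 : Tail ζ r (ζ r)
      · cases hζr : ζ r with
        | false =>
          rw [hζr] at hcol
          refine ⟨fun _ => ?_, fun h' => by simp_all⟩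
          refine ⟨pathSet_mono fun v hv => ?_, pathSet_mono fun v hv => ?_⟩
          · have := (suf_flipHead_iff_of_tail_mismatch hr hj₀ hne hT2 hi₁ v).2
              (by rw [hζr]; exact hv)
            rwa [hζr] at this
          · have := suf_anti_of_tail_mismatch hr hj₀ hne v (by rw [hζr]; exact hv)
            rwa [hζr] at this
        | true =>
          rw [hζr] at hcol
          refine ⟨fun h' => by simp_all, fun _ => ?_⟩
          refine ⟨pathSet_mono fun v hv => ?_, pathSet_mono fun v hv => ?_⟩
          · have := suf_anti_of_tail_mismatch hr hj₀ hne v (by rw [hζr]; exact hv)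
            rwa [hζr] at this
          · have := (suf_flipHead_iff_of_tail_mismatch hr hj₀ hne hT2 hi₁ v).2
              (by rw [hζr]; exact hv)
            rwa [hζr] at this
      · -- (A) the tail is not constant: the pair is unchanged
        have hT : ∀ d, ¬ Tail ζ r d := by
          intro d
          cases d <;> cases hζr : ζ r <;> simp_all
        have heq : (pathSet p (Suf (flipHead ζ) true), pathSet p (Suf (flipHead ζ) false)) =
            (pathSet p (Suf ζ true), pathSet p (Suf ζ false)) := by
          congr 1
          · exact pathSet_congr fun v => suf_flipHead_iff_of_not_tail hr hj₀ hne hT true v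
          · exact pathSet_congr fun v => suf_flipHead_iff_of_not_tail hr hj₀ hne hT false v
        rw [heq]
        exact ⟨fun _ => PairLE.refl _, fun _ => PairLE.refl _⟩

end Moves

/-- **The interface involution of a path is a side involution.** -/
theorem sideInvolution_path (hp : Function.Injective p) :
    SideInvolution (pathEnds p) (p 0) (p (Fin.last k)) flipHead headColour where
  mem ζ hU := by
    rw [last_notMem_hull_iff hp] at hU ⊢
    exact not_isConst_flipHead hU
  invol ζ _ := flipHead_flipHead ζ
  l_mirror ζ hU := by
    rw [last_notMem_hull_iff hp] at hU
    exact hullPair_zero_flipHead hp hU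
  h_up ζ hU hc := by
    rw [last_notMem_hull_iff hp] at hU
    exact (hullPair_last_flipHead_move hp hU).1 hc
  h_down ζ hU hc := by
    rw [last_notMem_hull_iff hp] at hU
    exact (hullPair_last_flipHead_move hp hU).2 hc
  diamond_up ζ hU hc := by
    rw [last_notMem_hull_iff hp] at hU
    exact diamond_path_up hp hU hc
  diamond_down ζ hU hc := by
    rw [last_notMem_hull_iff hp] at hU
    exact diamond_path_down hp hU hc

/-- **(MM) on two internally disjoint paths** glued at their ends (every cycle through `l`
and `h`). -/
theorem twoHullMaster_twoPaths {k₁ k₂ : ℕ} {p₁ : Fin (k₁ + 1) → V} {p₂ : Fin (k₂ + 1) → V}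
    (hp₁ : Function.Injective p₁) (hp₂ : Function.Injective p₂) {V₁ V₂ : Set V}
    (hg : IsGluing2 (pathEnds p₁) (pathEnds p₂) (p₁ 0) (p₁ (Fin.last k₁)) V₁ V₂)
    (h0 : p₂ 0 = p₁ 0) (hlast : p₂ (Fin.last k₂) = p₁ (Fin.last k₁)) :
    TwoHullMaster (glue2 (pathEnds p₁) (pathEnds p₂)) (p₁ 0) (p₁ (Fin.last k₁)) := by
  have s₂ : SideInvolution (pathEnds p₂) (p₁ 0) (p₁ (Fin.last k₁)) flipHead headColour := by
    rw [← h0, ← hlast]; exact sideInvolution_path hp₂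
  exact twoHullMaster_glue2 hg (sideInvolution_path hp₁) s₂

/-- **Theorem 2 of the record**: (MM) on `G_l ∪_l (P¹ ∪_{l,h} P²) ∪_h G_h` — two internally disjoint
`l`–`h` paths with arbitrary graphs glued at `l` and at `h`. -/
theorem twoHullMaster_twoPaths_glue {k₁ k₂ : ℕ} {p₁ : Fin (k₁ + 1) → V} {p₂ : Fin (k₂ + 1) → V}
    (hp₁ : Function.Injective p₁) (hp₂ : Function.Injective p₂) (hk : 0 < k₁) {V₁ V₂ : Set V}
    (hg : IsGluing2 (pathEnds p₁) (pathEnds p₂) (p₁ 0) (p₁ (Fin.last k₁)) V₁ V₂)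
    (h0 : p₂ 0 = p₁ 0) (hlast : p₂ (Fin.last k₂) = p₁ (Fin.last k₁))
    {E₃ E₄ : Type*} [Fintype E₃] [Fintype E₄] [DecidableEq E₃] [DecidableEq E₄]
    {ends₃ : E₃ → Sym2 V} {ends₄ : E₄ → Sym2 V} {VP V₃ V₄ : Set V}
    (hg₃ : Glue.IsGluing (glue2 (pathEnds p₁) (pathEnds p₂)) ends₃ (p₁ (Fin.last k₁)) VP V₃)
    (hl₃ : p₁ 0 ∈ VP)
    (hg₄ : Glue.IsGluing (Glue.glue (glue2 (pathEnds p₁) (pathEnds p₂)) ends₃) ends₄ (p₁ 0)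
      (VP ∪ V₃) V₄) :
    TwoHullMaster (Glue.glue (Glue.glue (glue2 (pathEnds p₁) (pathEnds p₂)) ends₃) ends₄)
      (p₁ 0) (p₁ (Fin.last k₁)) := by
  have hne : p₁ 0 ≠ p₁ (Fin.last k₁) := by
    intro h'
    have := hp₁ h'
    rw [Fin.ext_iff, Fin.val_zero, Fin.val_last] at this
    omega
  have h1 := twoHullMaster_twoPaths hp₁ hp₂ hg h0 hlast
  have h2 := Glue.twoHullMaster_glue_h hg₃ hl₃ hne h1
  exact Glue.twoHullMaster_glue_l hg₄ (Or.inl hg₃.c_mem₁) hne.symm h2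

end Path2

end Summit.Ventures.PercRepro2
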